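import Mathlib
import Summits.Ventures.PercRepro2.AS3Cases

/-!
# (SPLIT-MONO): slack monotone in the split set implies the pinned STEP family
(seat mine-b, cell pub-perc-repro2; conjectures/MINE-B.md §13 Addendum 4)

For an increasing event `A` with pins `O` and split set `Y`, the **STEP slack** at the row `(i,j)` is
`slack A O Y i j = H(i+1,j−1) − H(i,j)` (an integer).  The row (SPLIT-MONO) says that adding an
element `q` to the split set never decreases the slack: `slack A O Y i j ≤ slack A O (insert q Y) i j`
(`SplitMono`).  It is census-true on every port of every regular binary matroid on ≤ 9 elements
(679,404,672 instances at 9 elements, MINE-B.md §13 Addendum 5).  Here we record what it buys: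
the slack of the empty split set is non-negative (`slack_empty_nonneg`: with no split element the
red and blue configurations coincide, so `H(i,j) = 0` for `j ≥ i+2`), hence by induction on the
split set **(SPLIT-MONO) for `A` implies the pinned STEP inequality `H(i,j) ≤ H(i+1,j−1)` on every
pattern of `A`** (`absH_step_of_splitMono`) — the local, one-element-at-a-time form of the whole
STEP family (row (REG-STEP) / STEP(1,3) on λ = 3 strands): it suffices to prove the increment.
-/

open Finset

namespace Summit.Ventures.PercRepro2

namespace StepZero

open ReimerCube

variable {E : Type*} [DecidableEq E]

open Classical

/-- the STEP slack `H(i+1,j−1) − H(i,j)` of the pattern `(O, Y)` at the row `(i,j)` -/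
noncomputable def slack (A : Finset E → Prop) (O Y : Finset E) (i j : ℕ) : ℤ :=
  (absH A O Y (i + 1) (j - 1) : ℤ) - absH A O Y i j

/-- **(SPLIT-MONO)** for the event `A`: adding an element to the split set never decreases the STEP
slack, at every row `j ≥ i+2` and every pattern -/
def SplitMono (A : Finset E → Prop) : Prop :=
  ∀ (O Y : Finset E) (q : E), q ∉ O → q ∉ Y → ∀ i j : ℕ, i + 2 ≤ j →
    slack A O Y i j ≤ slack A O (insert q Y) i j

/-- `pinK` is antitone in the level: `k` disjoint witnesses give `k'` for `k' ≤ k` -/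
lemma pinK_of_le (A : Finset E → Prop) (O : Finset E) {k k' : ℕ} (h : k' ≤ k) {X : Finset E}
    (hX : pinK A O k X) : pinK A O k' X := by
  induction h with
  | refl => exact hX
  | step _ ih => exact ih (pinK_of_succ A O _ hX)
  
/-- with no split element the count `H(i,j)` vanishes for `j ≥ i+2` -/
lemma absH_empty_eq_zero (A : Finset E → Prop) (O : Finset E) (i j : ℕ) (hij : i + 2 ≤ j) :
    absH A O ∅ i j = 0 := by
  unfold absH
  rw [Finset.card_eq_zero, Finset.filter_eq_empty_iff]
  intro γ hγ
  rw [Finset.mem_powerset, Finset.subset_empty] at hγ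
  subst hγ
  rintro ⟨-, h2, h3⟩
  exact h2 (pinK_of_le A O (by omega) h3)

/-- the slack of the empty split set is non-negative -/
lemma slack_empty_nonneg (A : Finset E → Prop) (O : Finset E) (i j : ℕ) (hij : i + 2 ≤ j) :
    0 ≤ slack A O ∅ i j := by
  unfold slack
  rw [absH_empty_eq_zero A O i j hij]
  simp

/-- **(SPLIT-MONO) implies the pinned STEP family**: by induction on the split set, the slack of every
pattern `(O, Y)` with `O` and `Y` disjoint is non-negative, i.e. `H(i,j) ≤ H(i+1,j−1)`. -/
theorem absH_step_of_splitMono {A : Finset E → Prop} (h : SplitMono A) (O Y : Finset E)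
    (hOY : Disjoint O Y) (i j : ℕ) (hij : i + 2 ≤ j) :
    absH A O Y i j ≤ absH A O Y (i + 1) (j - 1) := by
  have key : ∀ Y : Finset E, Disjoint O Y → 0 ≤ slack A O Y i j := by
    intro Y
    induction Y using Finset.induction_on with
    | empty => intro _; exact slack_empty_nonneg A O i j hij
    | insert q Y hq ih =>
      intro hd
      have hqO : q ∉ O := fun h' => Finset.disjoint_left.mp hd h' (Finset.mem_insert_self q Y)
      have hd' : Disjoint O Y := Finset.disjoint_of_subset_right (Finset.subset_insert q Y) hd
      exact le_trans (ih hd') (h O Y q hqO hq i j hij)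
  have := key Y hOY
  unfold slack at this
  omega

end StepZero

end Summit.Ventures.PercRepro2
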